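import Literature.MathematicalPhysics.KineticTheory.InfiniteChainSuperstableEstimates
import Literature.MathematicalPhysics.KineticTheory.InfiniteChainObservables
import Literature.MathematicalPhysics.KineticTheory.ZeroWavenumberSpace
import HarnessLib

/-!
# Translations and momentum reversal of Buttà–Marchioro's good set; shift-invariant states

Topic `Literature/MathematicalPhysics/KineticTheory` (companion of `InfiniteChainSuperstableDynamics` /
`InfiniteChainSuperstableEstimates`, `InfiniteChainObservables` and `ZeroWavenumberSpace`). The symmetry
plumbing needed to feed an infinite-volume dynamics with carrier `𝒳₀ = bmGood P` (Buttà–Marchioro 2016,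
Thm 2.1) and a shift-invariant state into Doyon's zero-wavenumber structure `ZeroWavenumberData P D`
(fields `measurePreserving_shift`, `flow_comm_shift`, and `HasMomentumReversal.reversal_flow`):

* `bmLocalEnergy_chainShift`: `W_{m,k}(τ_x σ) = W_{m+x,k}(σ)` for the lattice translations
  `chainShift` of `ZeroWavenumberSpace`; hence **`𝒳₀` is translation invariant**
  (`chainShift_mem_bmGood`, `mapsTo_chainShift_bmGood`; the admissibility condition `k > log(e+|m|)`
  of BM's `Q` (2.5) is not translation invariant, so the proof goes through the general box bound
  `W_{m,k} ≤ Q(2k + 2log(e+|m|) + 3)`, BM (3.7), and `log(e+|m+x|) ≤ log(e+|m|) + log(1+|x|)`);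
* **`𝒳₀` is invariant under momentum reversal** (`momentumReversalZ_mem_bmGood_iff`; the local
  energies are even in the momenta), and `⇑momentumReversalZ = chainReversal` (the two names of the
  map in `InfiniteChainObservables` / `ZeroWavenumberSpace` agree definitionally);
* for a dynamics `D` with `D.carrier = bmGood P` and a measure `μ` carried by `𝒳₀`: the a.e.
  homogeneity `φ_t ∘ τ_x = τ_x ∘ φ_t` and reversibility `R ∘ φ_t = φ_{-t} ∘ R`
  (`flow_comp_chainShift_ae_of_carrier_eq_bmGood`, `chainReversal_comp_flow_ae_of_carrier_eq_bmGood`,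
  from the uniqueness-based lemmas of `ZeroWavenumberSpace`);
* **a shift-invariant state is preserved by every lattice translation**
  (`IsShiftInvariant.measurePreserving_chainShift`: `IsShiftInvariant μ` is `μ ∘ shift⁻¹ = μ` for the
  unit shift; `chainShift n` is its `n`-th iterate, `n ∈ ℤ`).

Everything is proved; tagged `[folklore]`. No definitions, no named facts.
-/

noncomputable section

open MeasureTheory Filter Set Function

namespace Literature.MathematicalPhysics.KineticTheory.HeatConduction

/-! ### The two names of the momentum reversal -/

/-- The measurable equivalence `momentumReversalZ` of `InfiniteChainObservables` and the map
`chainReversal` of `ZeroWavenumberSpace` are the same function. [folklore] -/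
@[simp] theorem coe_momentumReversalZ : (⇑momentumReversalZ : ChainConfig → ChainConfig) = chainReversal :=
  rfl

/-- `chainShift 1` is the unit shift `shift` of `InfiniteChainInvariantStates`. [folklore] -/
theorem chainShift_one : (chainShift 1 : ChainConfig → ChainConfig) = shift := rfl

/-- `chainShift (-1)` is the inverse unit shift. [folklore] -/
theorem chainShift_neg_one : (chainShift (-1) : ChainConfig → ChainConfig) = ⇑shiftEquiv.symm := by
  funext σ i
  simp only [chainShift_apply, shiftEquiv_symm_apply]
  rfl

/-! ### Shift-invariant states are preserved by all lattice translations -/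

/-- **A shift-invariant state is preserved by every lattice translation** `τ_x`, `x ∈ ℤ`. [folklore] -/
theorem IsShiftInvariant.measurePreserving_chainShift {μ : Measure ChainConfig}
    (hμ : IsShiftInvariant μ) (x : ℤ) : MeasurePreserving (chainShift x) μ μ := by
  have h1 : MeasurePreserving (chainShift 1) μ μ := by
    rw [chainShift_one]; exact ⟨shift_measurable, hμ⟩
  have hm1 : MeasurePreserving (chainShift (-1)) μ μ := by
    rw [chainShift_neg_one]; exact ⟨shiftEquiv.symm.measurable, hμ.map_shiftEquiv_symm⟩
  have hadd : ∀ a b : ℤ, (chainShift (a + b) : ChainConfig → ChainConfig) = chainShift a ∘ chainShift b :=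
    fun a b => funext fun σ => chainShift.apply_add a b σ
  induction x using Int.induction_on with
  | zero =>
      have h0 : (chainShift 0 : ChainConfig → ChainConfig) = id := funext (chainShift.apply_zero)
      rw [h0]; exact MeasurePreserving.id μ
  | succ n ih => rw [hadd]; exact ih.comp h1
  | pred n ih => rw [sub_eq_add_neg, hadd]; exact ih.comp hm1

namespace OscillatorChain

variable (P : OscillatorChain)

/-! ### Translations of the local energies and of `𝒳₀` -/

/-- **Translation covariance of the local energies**: `W_{m,k}(τ_x σ) = W_{m+x,k}(σ)`. [folklore] -/
theorem bmLocalEnergy_chainShift (m x : ℤ) (k : ℕ) (σ : ChainConfig) :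
    P.bmLocalEnergy m k (chainShift x σ) = P.bmLocalEnergy (m + x) k σ := by
  have hI : Finset.Icc (m + x - k) (m + x + k) =
      (Finset.Icc (m - k) (m + k)).map (addRightEmbedding x) := by
    rw [Finset.map_add_right_Icc]
    congr 1 <;> ring
  unfold bmLocalEnergy
  rw [hI]
  simp only [Finset.sum_map, addRightEmbedding_apply, chainShift_apply, add_sub_add_right_eq_sub]

/-- `log(e + |m + x|) ≤ log(e + |m|) + log(1 + |x|)`. [folklore] -/
theorem log_exp_add_abs_add_le (m x : ℤ) :
    Real.log (Real.exp 1 + |((m + x : ℤ) : ℝ)|) ≤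
      Real.log (Real.exp 1 + |(m : ℝ)|) + Real.log (1 + |(x : ℝ)|) := by
  have he : 0 < Real.exp 1 := Real.exp_pos 1
  have h1 : 0 < Real.exp 1 + |(m : ℝ)| := by positivity
  have h2 : 0 < 1 + |(x : ℝ)| := by positivity
  rw [← Real.log_mul h1.ne' h2.ne']
  refine Real.log_le_log (by positivity) ?_
  push_cast
  have hx := abs_nonneg (x : ℝ)
  have hm := abs_nonneg (m : ℝ)
  have hadd : |(m : ℝ) + x| ≤ |(m : ℝ)| + |(x : ℝ)| := abs_add_le _ _
  have h1e : (1 : ℝ) ≤ Real.exp 1 := Real.one_le_exp zero_le_one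
  nlinarith

variable {P}

/-- **`𝒳₀` is translation invariant** (`U, V ≥ 0`): `σ ∈ 𝒳₀ ⟹ τ_x σ ∈ 𝒳₀`, with
`Q(τ_x σ) ≤ Q(σ)(3 + 2 log(1+|x|))`. [folklore] -/
theorem chainShift_mem_bmGood (hU0 : ∀ r, 0 ≤ P.U r) (hV0 : ∀ r, 0 ≤ P.V r) {σ : ChainConfig}
    (hσ : σ ∈ P.bmGood) (x : ℤ) :
    chainShift x σ ∈ P.bmGood ∧
      P.bmGrowth (chainShift x σ) ≤ P.bmGrowth σ * (3 + 2 * Real.log (1 + |(x : ℝ)|)) := by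
  refine mem_bmGood_of_le fun m k hk => ?_
  have hQ1 : 1 ≤ P.bmGrowth σ := one_le_bmGrowth hU0 hV0 hσ
  have hpos : (0 : ℝ) < 2 * (k : ℝ) + 1 := by positivity
  have hl0 : 0 ≤ Real.log (1 + |(x : ℝ)|) := Real.log_nonneg (by linarith [abs_nonneg (x : ℝ)])
  rw [bmLocalEnergy_chainShift, div_le_iff₀ hpos]
  have h := bmLocalEnergy_le hU0 hV0 hσ (m + x) k
  have hlog := log_exp_add_abs_add_le m x
  have hk0 : (0 : ℝ) ≤ k := Nat.cast_nonneg k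
  calc P.bmLocalEnergy (m + x) k σ
      ≤ P.bmGrowth σ * (2 * (k : ℝ) + 2 * Real.log (Real.exp 1 + |((m + x : ℤ) : ℝ)|) + 3) := h
    _ ≤ P.bmGrowth σ * (2 * (k : ℝ) + 2 * ((k : ℝ) + Real.log (1 + |(x : ℝ)|)) + 3) := by
        refine mul_le_mul_of_nonneg_left ?_ (zero_le_one.trans hQ1)
        linarith
    _ ≤ P.bmGrowth σ * (3 + 2 * Real.log (1 + |(x : ℝ)|)) * (2 * (k : ℝ) + 1) := by
        rw [mul_assoc]
        refine mul_le_mul_of_nonneg_left ?_ (zero_le_one.trans hQ1)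
        nlinarith

/-- `τ_x` maps `𝒳₀` into itself (`U, V ≥ 0`). [folklore] -/
theorem mapsTo_chainShift_bmGood (hU0 : ∀ r, 0 ≤ P.U r) (hV0 : ∀ r, 0 ≤ P.V r) (x : ℤ) :
    MapsTo (chainShift x) P.bmGood P.bmGood := fun _ hσ =>
  (chainShift_mem_bmGood hU0 hV0 hσ x).1

/-! ### Momentum reversal of `𝒳₀` -/

variable (P)

/-- The local energies are even in the momenta (`chainReversal` form). [folklore] -/
@[simp] theorem bmLocalEnergy_chainReversal (m : ℤ) (k : ℕ) (σ : ChainConfig) :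
    P.bmLocalEnergy m k (chainReversal σ) = P.bmLocalEnergy m k σ := by
  simp only [bmLocalEnergy, chainReversal_apply, neg_sq]

/-- The set of normalised local energies is invariant under momentum reversal. [folklore] -/
@[simp] theorem bmGrowthSet_chainReversal (σ : ChainConfig) :
    P.bmGrowthSet (chainReversal σ) = P.bmGrowthSet σ := by
  simp only [bmGrowthSet, bmLocalEnergy_chainReversal]

/-- **`𝒳₀` is invariant under momentum reversal.** [folklore] -/
@[simp] theorem chainReversal_mem_bmGood_iff (σ : ChainConfig) :
    chainReversal σ ∈ P.bmGood ↔ σ ∈ P.bmGood := by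
  simp only [bmGood, mem_setOf_eq, bmGrowthSet_chainReversal]

/-- `𝒳₀` is invariant under `momentumReversalZ` (the `InfiniteChainObservables` name). [folklore] -/
theorem momentumReversalZ_mem_bmGood_iff (σ : ChainConfig) :
    momentumReversalZ σ ∈ P.bmGood ↔ σ ∈ P.bmGood := by
  rw [coe_momentumReversalZ, chainReversal_mem_bmGood_iff]

/-- `R` maps `𝒳₀` into itself. [folklore] -/
theorem mapsTo_chainReversal_bmGood : MapsTo chainReversal P.bmGood P.bmGood := fun σ hσ =>
  (P.chainReversal_mem_bmGood_iff σ).2 hσ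

end OscillatorChain

/-! ### Consequences for a dynamics with carrier `𝒳₀` -/

namespace InfiniteChainDynamics

variable {P : OscillatorChain} (D : InfiniteChainDynamics P)

/-- **Homogeneity of the flow on `𝒳₀`**: for `D.carrier = bmGood P` (`U, V ≥ 0`),
`φ_t (τ_x σ) = τ_x (φ_t σ)` for every `σ ∈ 𝒳₀`. [folklore] -/
theorem flow_chainShift_of_carrier_eq_bmGood (hcar : D.carrier = P.bmGood) (hU0 : ∀ r, 0 ≤ P.U r)
    (hV0 : ∀ r, 0 ≤ P.V r) {σ : ChainConfig} (hσ : σ ∈ P.bmGood) (t : ℝ) (x : ℤ) :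
    D.flow t (chainShift x σ) = chainShift x (D.flow t σ) := by
  refine D.flow_chainShift (fun y => ?_) (hcar ▸ hσ) t x
  rw [hcar]; exact OscillatorChain.mapsTo_chainShift_bmGood hU0 hV0 y

/-- A.e. homogeneity for a measure carried by `𝒳₀` (the field `flow_comm_shift` of
`ZeroWavenumberData`). [folklore] -/
theorem flow_comp_chainShift_ae_of_carrier_eq_bmGood (hcar : D.carrier = P.bmGood)
    (hU0 : ∀ r, 0 ≤ P.U r) (hV0 : ∀ r, 0 ≤ P.V r) {μ : Measure ChainConfig}
    (hμ : ∀ᵐ σ ∂μ, σ ∈ D.carrier) (t : ℝ) (x : ℤ) :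
    D.flow t ∘ chainShift x =ᵐ[μ] chainShift x ∘ D.flow t :=
  D.flow_comp_chainShift_ae (fun y => by rw [hcar]; exact OscillatorChain.mapsTo_chainShift_bmGood hU0 hV0 y)
    hμ t x

/-- **Reversibility of the flow on `𝒳₀`**: for `D.carrier = bmGood P`, `φ_t (R σ) = R (φ_{-t} σ)`
for every `σ ∈ 𝒳₀`. [folklore] -/
theorem flow_chainReversal_of_carrier_eq_bmGood (hcar : D.carrier = P.bmGood) {σ : ChainConfig}
    (hσ : σ ∈ P.bmGood) (t : ℝ) :
    D.flow t (chainReversal σ) = chainReversal (D.flow (-t) σ) := by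
  refine D.flow_chainReversal ?_ (hcar ▸ hσ) t
  rw [hcar]; exact OscillatorChain.mapsTo_chainReversal_bmGood P

/-- A.e. reversibility for a measure carried by `𝒳₀` (the field `reversal_flow` of
`ZeroWavenumberData.HasMomentumReversal`). [folklore] -/
theorem chainReversal_comp_flow_ae_of_carrier_eq_bmGood (hcar : D.carrier = P.bmGood)
    {μ : Measure ChainConfig} (hμ : ∀ᵐ σ ∂μ, σ ∈ D.carrier) (t : ℝ) :
    chainReversal ∘ D.flow t =ᵐ[μ] D.flow (-t) ∘ chainReversal :=
  D.chainReversal_comp_flow_ae (by rw [hcar]; exact OscillatorChain.mapsTo_chainReversal_bmGood P) hμ t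

end InfiniteChainDynamics

end Literature.MathematicalPhysics.KineticTheory.HeatConduction

end
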